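import Literature.NumberTheory.LFunctions.Zhang2022.KnifeEdgeRoughOverhang
import Literature.NumberTheory.LFunctions.Zhang2022.RepairRplusJoint

/-!
# Zhang (2022), programme F-S3 §E (cell landau-siegel, barrier extension, seat p3): the GLUE IDENTITY — the two-piece
# pencil of p442741 at `X = 0` IS the continued diagonal form of the glued ROUGH profile:
# `Re 𝔅_θ(s·u + v) = |s|²𝔅(u) + 2Re(s·π·conj(Φ_v)·L(u)) + Re 𝔅_θ(v) = twoPieceMainTerm θ 0 u u′ v v′ s`

Y. Zhang, *Discrete mean estimates and the Landau–Siegel zero*, arXiv:2211.02515v1 [Zhang2022LandauSiegel] —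
an unrefereed manuscript under adjudication. **WHAT THIS IS NOT: not a claim about Theorems 1–2 of
arXiv:2211.02515, about Landau–Siegel zeros, about a repaired `Margin232`, or about Parity; nothing here asserts any
claim of the manuscript. The programme SEARCHES and TYPES; no claim until a kernel theorem says so.** Companion of
`KnifeEdgeRoughOverhang` (p457552: `KnifeEdge.RoughOverhangPiece`, `rough_rankOneTailCoupling`,
`rough_closesByPositivity_zero`) and of `KnifeEdgeOverhangRankOne` (p442741: `KnifeEdge.twoPieceMainTerm`).

**What is proved.** p442741 DEFINED the two-piece constant `q_X(s) = |s|²𝔅(u) + 2Re(s·(πΦ̄_vL(u) + X(u,v))) +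
Re 𝔅_θ(v) + 2Re X(v,v)` and proved the rank-one coupling `M_θ(u,v) = πΦ̄_vL(u)`, `M_θ(v,u) = 0`, but no theorem of the
tree says that `q_0(s)` is the continued diagonal form `Re 𝔅_θ = 2Re M_θ` (`Repair.topDiagForm`) of the GLUED profile
`s·u + v` — the object `Repair.topForm_indefinite` speaks about. This file proves it, on the ROUGH class (so a
fortiori on the smooth one): for `θ ≥ 1`, `u` in class, `v` a rough overhang piece and any `s ∈ ℂ`,
**`(topDiagForm θ (s·u + v) (s·u′ + v′)).re = twoPieceMainTerm θ 0 u u′ v v′ s`** (`topDiagForm_glue_re`). Ingredients: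
(i) the four dipole integrands of the pair `(u, v)` are integrable on `[0, θ]` (`intervalIntegrable_dipoleTop_*`; the
`(v,v)` one by `L²·L²` on `(1,θ]` against the continuous tail — this is where `RoughOverhangPiece.memLp/memLp'` are
used); (ii) the integrand of the glued profile splits pointwise as `ss̄·D(u,u) + s·D(u,v) + s̄·D(v,u) + D(v,v)`
(`dipoleIntegrandTop_glue`), hence `M_θ(s·u+v) = ss̄·M_θ(u,u) + s·M_θ(u,v) + s̄·M_θ(v,u) + M_θ(v,v)` (`MformTop_glue`);
(iii) `M_θ(u,u) = M(u,u)` for an in-class piece at every `θ ≥ 1` (`MformTop_inClass`) and `2Re M(u,u) = 𝔅(u)`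
(`two_mul_re_Mform_inClass`, the Gram identity of `RepairFormulaIGram`); (iv) the rank-one coupling of p457552.

**Consequences (Part 4).** `roughNull_zero_iff_topDiagForm`: the rough null in the world `X = 0` is EXACTLY positivity
of the continued form on glued rough profiles; `topDiagForm_glue_plateau_neg` — for every `θ > 1` the glued ROUGH
one-sided profile `−2·g⋆ + 𝟙_[1,θ)` has `Re 𝔅_θ = −32π(θ−1) < 0` (the plateau version of `Repair.topForm_indefinite`:
no cubic, the jump at the wall does the work) — CURRENCY: continued diagonal calculus only (cell rule C3(e); validity
off class `R`: registry E-017 / E-002 open; `X = 0` is not the (A)-world).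

Deliberately NOT here: the `X ≠ 0` worlds (by definition `X` is not part of `M_θ`); several in-class pieces
(`KnifeEdge.familyRoughThreePiece`, p461544, reduces to this by `InClassPiece.add_smul`). No numeric certificate;
axioms standard. References: Zhang, arXiv:2211.02515v1, §7 Prop 7.1, (7.2) p.44, §8 (8.11)–(8.12)
[cite: Zhang2022LandauSiegel, §7 Prop 7.1 (7.2), §8 (8.11)–(8.12)].
-/

noncomputable section

open Complex Real ComplexConjugate Set intervalIntegral
open _root_.MeasureTheory

namespace Literature.NumberTheory.LFunctions.Zhang2022

namespace KnifeEdge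

open Repair

variable {θ : ℝ} {u u' v v' : ℝ → ℂ}

/-! ### Part 1 — tails of the two pieces and the pointwise split of the glued dipole integrand -/

/-- The tail of an in-class piece stops at the wall: `∫_y^θ u = ∫_y^1 u` for `θ ≥ 1`, `0 ≤ y ≤ 1`.
[cite: Zhang2022LandauSiegel, Prop 7.1 p.44, (8.11)–(8.12)] -/
theorem tail_inClass_eq_tail_one (hθ : 1 ≤ θ) (hu : InClassPiece u u') {y : ℝ} (hy : y ∈ Icc (0:ℝ) 1) :
    ∫ t in y..θ, u t = ∫ t in y..1, u t := by
  have i1 : IntervalIntegrable u volume y 1 :=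
    (hu.kinked.cont.mono (Icc_subset_Icc_left hy.1)).intervalIntegrable_of_Icc hy.2
  have i2 : IntervalIntegrable u volume 1 θ :=
    ((continuousOn_const (c := (0:ℂ))).congr fun t ht => hu.vanish t ht.1).intervalIntegrable_of_Icc hθ
  rw [← intervalIntegral.integral_add_adjacent_intervals i1 i2, tail_inClass_eq_zero hu le_rfl hθ, add_zero]

/-- An in-class piece is interval-integrable on `[y, θ]` for `0 ≤ y ≤ θ`, `θ ≥ 1`. [cite: Zhang2022LandauSiegel, Prop 7.1 p.44, (7.2)] -/
theorem InClassPiece.intervalIntegrable_sub (hu : InClassPiece u u') (hθ : 1 ≤ θ) {y : ℝ} (hy0 : 0 ≤ y)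
    (hyθ : y ≤ θ) : IntervalIntegrable u volume y θ := by
  rcases le_or_gt y 1 with hy1 | hy1
  · have i1 : IntervalIntegrable u volume y 1 :=
      (hu.kinked.cont.mono (Icc_subset_Icc_left hy0)).intervalIntegrable_of_Icc hy1
    have i2 : IntervalIntegrable u volume 1 θ :=
      ((continuousOn_const (c := (0:ℂ))).congr fun t ht => hu.vanish t ht.1).intervalIntegrable_of_Icc hθ
    exact i1.trans i2
  · refine (intervalIntegrable_const (c := (0:ℂ))).congr_uIoo fun t ht => ?_
    rw [uIoo_of_le hyθ] at ht
    exact (hu.vanish t (hy1.le.trans ht.1.le)).symm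

/-- A rough overhang piece is interval-integrable on `[y, θ]` for `0 ≤ y ≤ θ`, `θ ≥ 1`. [cite: Zhang2022LandauSiegel, Prop 7.1 p.44, (7.2)] -/
theorem RoughOverhangPiece.intervalIntegrable_sub (hv : RoughOverhangPiece θ v v') (hθ : 1 ≤ θ) {y : ℝ}
    (hyθ : y ≤ θ) : IntervalIntegrable v volume y θ := by
  rcases le_or_gt y 1 with hy1 | hy1
  · have i1 : IntervalIntegrable v volume y 1 := by
      refine (intervalIntegrable_const (c := (0:ℂ))).congr_uIoo fun t ht => ?_
      rw [uIoo_of_le hy1] at ht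
      exact (hv.vanish t ht.2).symm
    exact i1.trans (hv.intervalIntegrable hθ)
  · exact (hv.intervalIntegrable hθ).mono_set (by
      rw [uIcc_of_le hyθ, uIcc_of_le hθ]; exact Icc_subset_Icc_left hy1.le)

/-- **Pointwise split of the glued dipole integrand**: at a point `y` where both tails exist,
`D_j(s·u+v, s·u+v)(y) = ss̄·D_j(u,u)(y) + s·D_j(u,v)(y) + s̄·D_j(v,u)(y) + D_j(v,v)(y)`.
[cite: Zhang2022LandauSiegel, Prop 7.1 p.44, (8.11)–(8.12)] -/
theorem dipoleIntegrandTop_glue {T : ℝ} (j : ℕ) (s : ℂ) {y : ℝ} (hiu : IntervalIntegrable u volume y T)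
    (hiv : IntervalIntegrable v volume y T) :
    dipoleIntegrandTop T j (fun t => s * u t + v t) (fun t => s * u' t + v' t) (fun t => s * u t + v t)
        (fun t => s * u' t + v' t) y
      = s * conj s * dipoleIntegrandTop T j u u' u u' y + s * dipoleIntegrandTop T j u u' v v' y
        + conj s * dipoleIntegrandTop T j v v' u u' y + dipoleIntegrandTop T j v v' v v' y := by
  have htail : ∫ t in y..T, s * u t + v t = s * (∫ t in y..T, u t) + ∫ t in y..T, v t := by
    rw [intervalIntegral.integral_add (hiu.const_mul s) hiv, intervalIntegral.integral_const_mul]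
  unfold dipoleIntegrandTop
  rw [htail]
  simp only [map_add, map_mul]
  ring

/-! ### Part 2 — the four dipole integrands of the pair `(u, v)` are integrable on `[0, θ]` -/

section Integrability

/-- `D_j(u,u)` on `[0,θ]`: formula I's integrand on `(0,1)` (`Repair.intervalIntegrable_dipoleIntegrand`), `0` beyond.
[cite: Zhang2022LandauSiegel, Prop 7.1 p.44, (8.11)–(8.12)] -/
theorem intervalIntegrable_dipoleTop_uu (hθ : 1 ≤ θ) (hu : InClassPiece u u') (j : ℕ) :
    IntervalIntegrable (dipoleIntegrandTop θ j u u' u u') volume 0 θ := by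
  have i1 : IntervalIntegrable (dipoleIntegrandTop θ j u u' u u') volume 0 1 := by
    refine (intervalIntegrable_dipoleIntegrand hu.kinked hu.kinked j).congr_uIoo fun y hy => ?_
    rw [uIoo_of_le zero_le_one] at hy
    unfold dipoleIntegrand dipoleIntegrandTop
    rw [tail_inClass_eq_tail_one hθ hu ⟨hy.1.le, hy.2.le⟩]
  have i2 : IntervalIntegrable (dipoleIntegrandTop θ j u u' u u') volume 1 θ := by
    refine (intervalIntegrable_const (c := (0:ℂ))).congr_uIoo fun y hy => ?_
    rw [uIoo_of_le hθ] at hy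
    unfold dipoleIntegrandTop
    rw [hu.vanish' y hy.1.le, hu.vanish y hy.1.le]
    ring
  exact i1.trans i2

/-- `D_j(u,v)` on `[0,θ]`: `conj(π²N_jΦ_v)·(u′ + iπju)` on `(0,1)`, `0` beyond.
[cite: Zhang2022LandauSiegel, Prop 7.1 p.44, (8.11)–(8.12)] -/
theorem intervalIntegrable_dipoleTop_uv (hθ : 1 ≤ θ) (hu : InClassPiece u u') (hv : RoughOverhangPiece θ v v')
    (j : ℕ) : IntervalIntegrable (dipoleIntegrandTop θ j u u' v v') volume 0 θ := by
  set c : ℂ := conj ((π : ℂ) ^ 2 * ((bN j : ℝ) : ℂ) * overhangMass θ v) with hc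
  have iu' : IntervalIntegrable u' volume 0 1 := hu.kinked.isH1.intervalIntegrable
  have iu : IntervalIntegrable (fun y => I * π * (j : ℂ) * u y) volume 0 1 :=
    (hu.kinked.cont.intervalIntegrable_of_Icc zero_le_one).const_mul _
  have i1 : IntervalIntegrable (dipoleIntegrandTop θ j u u' v v') volume 0 1 := by
    refine ((iu'.add iu).const_mul c).congr_uIoo fun y hy => ?_
    rw [uIoo_of_le zero_le_one] at hy
    simp only [dipoleIntegrandTop, hv.vanish' y hy.2, hv.vanish y hy.2, rough_tail_eq_overhangMass hθ hv hy.2.le, hc]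
    ring
  have i2 : IntervalIntegrable (dipoleIntegrandTop θ j u u' v v') volume 1 θ := by
    refine (intervalIntegrable_const (c := (0:ℂ))).congr_uIoo fun y hy => ?_
    rw [uIoo_of_le hθ] at hy
    simp only [dipoleIntegrandTop, hu.vanish' y hy.1.le, hu.vanish y hy.1.le]
    ring
  exact i1.trans i2

/-- `D_j(v,u)` vanishes on `(0,1) ∪ (1,θ)`, hence is integrable on `[0,θ]`.
[cite: Zhang2022LandauSiegel, Prop 7.1 p.44, (8.11)–(8.12)] -/
theorem intervalIntegrable_dipoleTop_vu (hθ : 1 ≤ θ) (hu : InClassPiece u u') (hv : RoughOverhangPiece θ v v')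
    (j : ℕ) : IntervalIntegrable (dipoleIntegrandTop θ j v v' u u') volume 0 θ := by
  have i1 : IntervalIntegrable (dipoleIntegrandTop θ j v v' u u') volume 0 1 := by
    refine (intervalIntegrable_const (c := (0:ℂ))).congr_uIoo fun y hy => ?_
    rw [uIoo_of_le zero_le_one] at hy
    simp only [dipoleIntegrandTop, hv.vanish' y hy.2, hv.vanish y hy.2]
    ring
  have i2 : IntervalIntegrable (dipoleIntegrandTop θ j v v' u u') volume 1 θ := by
    refine (intervalIntegrable_const (c := (0:ℂ))).congr_uIoo fun y hy => ?_
    rw [uIoo_of_le hθ] at hy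
    simp [dipoleIntegrandTop, hu.vanish' y hy.1.le, hu.vanish y hy.1.le, tail_inClass_eq_zero hu hy.1.le hθ]
  exact i1.trans i2

/-- The tail `y ↦ ∫_y^θ v` of a rough overhang piece is continuous on `[1, θ]`.
[cite: Zhang2022LandauSiegel, Prop 7.1 p.44, (8.11)–(8.12)] -/
theorem RoughOverhangPiece.continuousOn_tail (hv : RoughOverhangPiece θ v v') (hθ : 1 ≤ θ) :
    ContinuousOn (fun y => ∫ t in y..θ, v t) (Icc 1 θ) := by
  have hint : IntegrableOn v (uIcc 1 θ) volume := by
    rw [uIcc_of_le hθ, integrableOn_Icc_iff_integrableOn_Ioc]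
    exact hv.memLp.integrable one_le_two
  have := intervalIntegral.continuousOn_primitive_interval_left (μ := volume) (f := v) (a := 1) (b := θ) hint
  rwa [uIcc_of_le hθ] at this

/-- `D_j(v,v)` on `[0,θ]`: `0` below the wall; on `(1,θ]` the product of two `L²` functions (`v′ + iπjv` and
`v′ + iπS_jv + π²N_j·tail`, the tail continuous hence bounded) — integrable. This is where the `L²` clauses of
`RoughOverhangPiece` are used. [cite: Zhang2022LandauSiegel, Prop 7.1 p.44, (8.11)–(8.12)] -/
theorem intervalIntegrable_dipoleTop_vv (hθ : 1 ≤ θ) (hv : RoughOverhangPiece θ v v') (j : ℕ) :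
    IntervalIntegrable (dipoleIntegrandTop θ j v v' v v') volume 0 θ := by
  have i1 : IntervalIntegrable (dipoleIntegrandTop θ j v v' v v') volume 0 1 := by
    refine (intervalIntegrable_const (c := (0:ℂ))).congr_uIoo fun y hy => ?_
    rw [uIoo_of_le zero_le_one] at hy
    simp only [dipoleIntegrandTop, hv.vanish' y hy.2, hv.vanish y hy.2]
    ring
  -- on `(1, θ]`: `L² · L²`
  set μ := volume.restrict (Ioc 1 θ) with hμ
  have hF : MemLp (fun y => v' y + I * π * (j : ℂ) * v y) 2 μ := hv.memLp'.add (hv.memLp.const_mul _)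
  -- the tail is continuous on `[1,θ]`, hence bounded and in `L²` on the finite interval
  obtain ⟨C, hC⟩ := isCompact_Icc.exists_bound_of_continuousOn (hv.continuousOn_tail hθ)
  have hT : MemLp (fun y => ∫ t in y..θ, v t) 2 μ := by
    refine MemLp.of_bound (((hv.continuousOn_tail hθ).mono Ioc_subset_Icc_self).aestronglyMeasurable
      measurableSet_Ioc) C ?_
    filter_upwards [ae_restrict_mem measurableSet_Ioc] with y hy using hC y (Ioc_subset_Icc_self hy)
  have hG : MemLp (fun y => v' y + I * π * ((bS j : ℝ) : ℂ) * v y + (π : ℂ) ^ 2 * ((bN j : ℝ) : ℂ) * ∫ t in y..θ, v t)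
      2 μ := (hv.memLp'.add (hv.memLp.const_mul _)).add (hT.const_mul _)
  have hGc : MemLp (fun y => conj (v' y + I * π * ((bS j : ℝ) : ℂ) * v y
      + (π : ℂ) ^ 2 * ((bN j : ℝ) : ℂ) * ∫ t in y..θ, v t)) 2 μ := by
    refine MemLp.of_le hG (Complex.continuous_conj.comp_aestronglyMeasurable hG.1) ?_
    filter_upwards with y
    rw [Complex.norm_conj]
  have hprod : Integrable (fun y => (v' y + I * π * (j : ℂ) * v y) * conj (v' y + I * π * ((bS j : ℝ) : ℂ) * v y
      + (π : ℂ) ^ 2 * ((bN j : ℝ) : ℂ) * ∫ t in y..θ, v t)) μ := hF.integrable_mul hGc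
  have i2 : IntervalIntegrable (dipoleIntegrandTop θ j v v' v v') volume 1 θ := by
    rw [intervalIntegrable_iff_integrableOn_Ioc_of_le hθ]
    exact hprod
  exact i1.trans i2

end Integrability

/-! ### Part 3 — the glue identities: `M_θ` of the glued profile, `M_θ(u,u) = M(u,u)`, `2Re M(u,u) = 𝔅(u)` -/

/-- **`M_θ(s·u + v) = ss̄·M_θ(u,u) + s·M_θ(u,v) + s̄·M_θ(v,u) + M_θ(v,v)`** for an in-class `u`, a rough overhang `v`,
`θ ≥ 1` (sesquilinear expansion of the continued formula I, justified by Part 2's integrability).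
[cite: Zhang2022LandauSiegel, Prop 7.1 p.44, (8.11)–(8.12)] -/
theorem MformTop_glue (hθ : 1 ≤ θ) (hu : InClassPiece u u') (hv : RoughOverhangPiece θ v v') (s : ℂ) :
    MformTop θ (fun t => s * u t + v t) (fun t => s * u' t + v' t) (fun t => s * u t + v t) (fun t => s * u' t + v' t)
      = s * conj s * MformTop θ u u' u u' + s * MformTop θ u u' v v' + conj s * MformTop θ v v' u u'
        + MformTop θ v v' v v' := by
  have h0 : (0:ℝ) ≤ θ := zero_le_one.trans hθ
  have key : ∀ j : ℕ, ∫ y in (0:ℝ)..θ, dipoleIntegrandTop θ j (fun t => s * u t + v t) (fun t => s * u' t + v' t)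
      (fun t => s * u t + v t) (fun t => s * u' t + v' t) y
      = s * conj s * (∫ y in (0:ℝ)..θ, dipoleIntegrandTop θ j u u' u u' y)
        + s * (∫ y in (0:ℝ)..θ, dipoleIntegrandTop θ j u u' v v' y)
        + conj s * (∫ y in (0:ℝ)..θ, dipoleIntegrandTop θ j v v' u u' y)
        + ∫ y in (0:ℝ)..θ, dipoleIntegrandTop θ j v v' v v' y := by
    intro j
    have huu := intervalIntegrable_dipoleTop_uu hθ hu j
    have huv := intervalIntegrable_dipoleTop_uv hθ hu hv j
    have hvu := intervalIntegrable_dipoleTop_vu hθ hu hv j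
    have hvv := intervalIntegrable_dipoleTop_vv hθ hv j
    have hcongr : ∫ y in (0:ℝ)..θ, dipoleIntegrandTop θ j (fun t => s * u t + v t) (fun t => s * u' t + v' t)
        (fun t => s * u t + v t) (fun t => s * u' t + v' t) y
        = ∫ y in (0:ℝ)..θ, (s * conj s * dipoleIntegrandTop θ j u u' u u' y + s * dipoleIntegrandTop θ j u u' v v' y
          + conj s * dipoleIntegrandTop θ j v v' u u' y + dipoleIntegrandTop θ j v v' v v' y) :=
      intervalIntegral.integral_congr_uIoo fun y hy => by
        rw [uIoo_of_le h0] at hy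
        exact dipoleIntegrandTop_glue j s (hu.intervalIntegrable_sub hθ hy.1.le hy.2.le)
          (hv.intervalIntegrable_sub hθ hy.2.le)
    have hA := huu.const_mul (s * conj s)
    have hB := huv.const_mul s
    have hC := hvu.const_mul (conj s)
    rw [hcongr, intervalIntegral.integral_add ((hA.add hB).add hC) hvv, intervalIntegral.integral_add (hA.add hB) hC,
      intervalIntegral.integral_add hA hB, intervalIntegral.integral_const_mul, intervalIntegral.integral_const_mul,
      intervalIntegral.integral_const_mul]
  unfold MformTop
  rw [key 1, key 2, key 3]
  ring

/-- **`M_θ(u,u) = M(u,u)`** for an in-class piece at every `θ ≥ 1` (the piece does not see the top).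
[cite: Zhang2022LandauSiegel, Prop 7.1 p.44, (8.11)–(8.12)] -/
theorem MformTop_inClass (hθ : 1 ≤ θ) (hu : InClassPiece u u') : MformTop θ u u' u u' = Mform u u' u u' := by
  have key : ∀ j : ℕ, ∫ y in (0:ℝ)..θ, dipoleIntegrandTop θ j u u' u u' y
      = ∫ y in (0:ℝ)..1, dipoleIntegrand j u u' u u' y := by
    intro j
    have i1 : IntervalIntegrable (dipoleIntegrandTop θ j u u' u u') volume 0 1 :=
      (intervalIntegrable_dipoleTop_uu hθ hu j).mono_set (by
        rw [uIcc_of_le zero_le_one, uIcc_of_le (zero_le_one.trans hθ)]; exact Icc_subset_Icc_right hθ)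
    have i2 : IntervalIntegrable (dipoleIntegrandTop θ j u u' u u') volume 1 θ :=
      (intervalIntegrable_dipoleTop_uu hθ hu j).mono_set (by
        rw [uIcc_of_le hθ, uIcc_of_le (zero_le_one.trans hθ)]; exact Icc_subset_Icc_left zero_le_one)
    have e2 : ∫ y in (1:ℝ)..θ, dipoleIntegrandTop θ j u u' u u' y = 0 := by
      rw [intervalIntegral.integral_congr_uIoo (g := fun _ => (0:ℂ)) fun y hy => ?_, intervalIntegral.integral_zero]
      rw [uIoo_of_le hθ] at hy
      unfold dipoleIntegrandTop
      rw [hu.vanish' y hy.1.le, hu.vanish y hy.1.le]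
      ring
    rw [← intervalIntegral.integral_add_adjacent_intervals i1 i2, e2, add_zero]
    refine intervalIntegral.integral_congr_uIoo fun y hy => ?_
    rw [uIoo_of_le zero_le_one] at hy
    unfold dipoleIntegrand dipoleIntegrandTop
    rw [tail_inClass_eq_tail_one hθ hu ⟨hy.1.le, hy.2.le⟩]
  unfold MformTop Mform
  rw [key 1, key 2, key 3]

/-- **`2Re M(u,u) = 𝔅(u)`** for an in-class piece (the Gram identity `P(u,u) = M(u,u) + conj M(u,u)` of
`RepairFormulaIGram`, `u(1) = 0`, and `P(u,u) = 𝔅(u)`). [cite: Zhang2022LandauSiegel, Prop 7.1 p.44, (8.11)–(8.23)] -/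
theorem two_mul_re_Mform_inClass (hu : InClassPiece u u') : 2 * (Mform u u' u u').re = mainTermForm u u' := by
  have h1 : u 1 = 0 := hu.vanish 1 le_rfl
  have h := mainTermFormPolar_eq_Mform hu.kinked hu.kinked h1 h1
  rw [mainTermFormPolar_self] at h
  have := congrArg Complex.re h
  rw [Complex.ofReal_re, Complex.add_re, Complex.conj_re] at this
  linarith

/-- **THE GLUE IDENTITY.** For `θ ≥ 1`, an in-class piece `u`, a rough overhang piece `v` and any scalar `s`:
`Re 𝔅_θ(s·u + v) = |s|²𝔅(u) + 2Re(s·π·conj(Φ_v)·L(u)) + Re 𝔅_θ(v) = twoPieceMainTerm θ 0 u u′ v v′ s` — the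
two-piece pencil of p442741 in the world `X = 0` IS the continued diagonal form of the glued profile.
[cite: Zhang2022LandauSiegel, Prop 7.1 p.44, (7.2), (8.11)–(8.12)] -/
theorem topDiagForm_glue_re (hθ : 1 ≤ θ) (hu : InClassPiece u u') (hv : RoughOverhangPiece θ v v') (s : ℂ) :
    (topDiagForm θ (fun t => s * u t + v t) (fun t => s * u' t + v' t)).re = twoPieceMainTerm θ 0 u u' v v' s := by
  obtain ⟨huv, hvu⟩ := rough_rankOneTailCoupling hθ hu hv
  rw [topDiagForm_re, MformTop_glue hθ hu hv s, MformTop_inClass hθ hu, huv, hvu, twoPieceMainTerm,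
    topDiagForm_re, ← two_mul_re_Mform_inClass hu, Complex.mul_conj']
  have e0 : ((0 : PairFunctional) u u' v v') = 0 := rfl
  have e0' : ((0 : PairFunctional) v v' v v') = 0 := rfl
  rw [e0, e0']
  simp only [Complex.add_re, mul_zero, Complex.zero_re, add_zero]
  rw [← Complex.ofReal_pow, Complex.re_ofReal_mul]
  ring

/-! ### Part 4 — consequences: the rough null at `X = 0` is positivity of the continued form; a glued rough profile
with negative continued form at every `θ > 1` (no cubic) -/

/-- **The rough null in the world `X = 0` IS positivity of the continued form on glued rough profiles.**
[cite: Zhang2022LandauSiegel, Prop 7.1 p.44, (7.2)] -/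
theorem roughNull_zero_iff_topDiagForm (hθ : 1 ≤ θ) :
    NullOn (RoughOverhangPiece θ) θ 0 ↔ ∀ (u u' v v' : ℝ → ℂ) (s : ℂ), InClassPiece u u' → RoughOverhangPiece θ v v' →
      0 ≤ (topDiagForm θ (fun t => s * u t + v t) (fun t => s * u' t + v' t)).re := by
  constructor
  · intro h u u' v v' s hu hv
    rw [topDiagForm_glue_re hθ hu hv s]
    exact h u u' v v' s hu hv
  · intro h u u' v v' s hu hv
    rw [← topDiagForm_glue_re hθ hu hv s]
    exact h u u' v v' s hu hv

/-- **A glued ROUGH profile with NEGATIVE continued form at every `θ > 1`, no cubic needed:**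
`Re 𝔅_θ(−2·g⋆ + 𝟙_[1,θ)) = −32π(θ−1)` (the wall jump of the plateau couples to the kernel mode `g⋆` through the
rank-one tail with `24π(θ−1)`; `𝔅(g⋆) = 0`; plateau block `64π(θ−1)`). The rough twin of `Repair.topForm_indefinite`.
CURRENCY: continued diagonal calculus only; validity off `R`: registry E-017 open; `X = 0` is not the (A)-world.
[cite: Zhang2022LandauSiegel, Prop 7.1 p.44, (7.2)] -/
theorem topDiagForm_glue_plateau_neg (hθ : 1 < θ) :
    (topDiagForm θ (fun t => ((-2 : ℝ) : ℂ) * gStar t + plateau θ t) (fun t => ((-2 : ℝ) : ℂ) * gStar' t + 0)).re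
      = -(32 * π * (θ - 1)) := by
  have h := topDiagForm_glue_re hθ.le inClassPiece_gStar (roughOverhangPiece_plateau θ) ((-2 : ℝ) : ℂ)
  simp only [add_zero] at h ⊢
  rw [h, twoPieceMainTerm_zero_gStar_plateau hθ.le]
  ring

/-- … hence the continued form of a one-sided ROUGH profile of every length `θ > 1` can be negative: the length knife
edge `θ_max = 1` on the rough class, by an explicit jump design. [cite: Zhang2022LandauSiegel, Prop 7.1 p.44, (7.2)] -/
theorem exists_rough_glued_topDiagForm_neg (hθ : 1 < θ) :
    ∃ (u u' v v' : ℝ → ℂ) (s : ℂ), InClassPiece u u' ∧ RoughOverhangPiece θ v v' ∧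
      (topDiagForm θ (fun t => s * u t + v t) (fun t => s * u' t + v' t)).re < 0 := by
  refine ⟨gStar, gStar', plateau θ, fun _ => 0, ((-2 : ℝ) : ℂ), inClassPiece_gStar, roughOverhangPiece_plateau θ, ?_⟩
  rw [topDiagForm_glue_re hθ.le inClassPiece_gStar (roughOverhangPiece_plateau θ), twoPieceMainTerm_zero_gStar_plateau hθ.le]
  have hπ : 0 < π := Real.pi_pos
  nlinarith

/-! ### Part 5 — the JOINT-currency glue: the polar pairing of the glued rough profile with an in-class probe IS
`Repair.twoPieceCross` at `X = 0` (`𝔡 + 𝔡′` of p457753 / p461544 as a continued-calculus object) -/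

section JointGlue

variable {f f' : ℝ → ℂ}

/-- `D_j(u,f)` for two in-class pieces is integrable on `[0,θ]` (formula I's integrand on `(0,1)`, `0` beyond).
[cite: Zhang2022LandauSiegel, Prop 7.1 p.44, (8.11)–(8.12)] -/
theorem intervalIntegrable_dipoleTop_inClass (hθ : 1 ≤ θ) (hu : InClassPiece u u') (hf : InClassPiece f f') (j : ℕ) :
    IntervalIntegrable (dipoleIntegrandTop θ j u u' f f') volume 0 θ := by
  have i1 : IntervalIntegrable (dipoleIntegrandTop θ j u u' f f') volume 0 1 := by
    refine (intervalIntegrable_dipoleIntegrand hu.kinked hf.kinked j).congr_uIoo fun y hy => ?_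
    rw [uIoo_of_le zero_le_one] at hy
    unfold dipoleIntegrand dipoleIntegrandTop
    rw [tail_inClass_eq_tail_one hθ hf ⟨hy.1.le, hy.2.le⟩]
  have i2 : IntervalIntegrable (dipoleIntegrandTop θ j u u' f f') volume 1 θ := by
    refine (intervalIntegrable_const (c := (0:ℂ))).congr_uIoo fun y hy => ?_
    rw [uIoo_of_le hθ] at hy
    unfold dipoleIntegrandTop
    rw [hu.vanish' y hy.1.le, hu.vanish y hy.1.le]
    ring
  exact i1.trans i2

/-- `M_θ(u,f) = M(u,f)` for two in-class pieces at every `θ ≥ 1`. [cite: Zhang2022LandauSiegel, Prop 7.1 p.44, (8.11)–(8.12)] -/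
theorem MformTop_inClass_pair (hθ : 1 ≤ θ) (hu : InClassPiece u u') (hf : InClassPiece f f') :
    MformTop θ u u' f f' = Mform u u' f f' := by
  have key : ∀ j : ℕ, ∫ y in (0:ℝ)..θ, dipoleIntegrandTop θ j u u' f f' y
      = ∫ y in (0:ℝ)..1, dipoleIntegrand j u u' f f' y := by
    intro j
    have hI := intervalIntegrable_dipoleTop_inClass hθ hu hf j
    have i1 : IntervalIntegrable (dipoleIntegrandTop θ j u u' f f') volume 0 1 :=
      hI.mono_set (by rw [uIcc_of_le zero_le_one, uIcc_of_le (zero_le_one.trans hθ)]; exact Icc_subset_Icc_right hθ)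
    have i2 : IntervalIntegrable (dipoleIntegrandTop θ j u u' f f') volume 1 θ :=
      hI.mono_set (by rw [uIcc_of_le hθ, uIcc_of_le (zero_le_one.trans hθ)]; exact Icc_subset_Icc_left zero_le_one)
    have e2 : ∫ y in (1:ℝ)..θ, dipoleIntegrandTop θ j u u' f f' y = 0 := by
      rw [intervalIntegral.integral_congr_uIoo (g := fun _ => (0:ℂ)) fun y hy => ?_, intervalIntegral.integral_zero]
      rw [uIoo_of_le hθ] at hy
      unfold dipoleIntegrandTop
      rw [hu.vanish' y hy.1.le, hu.vanish y hy.1.le]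
      ring
    rw [← intervalIntegral.integral_add_adjacent_intervals i1 i2, e2, add_zero]
    refine intervalIntegral.integral_congr_uIoo fun y hy => ?_
    rw [uIoo_of_le zero_le_one] at hy
    unfold dipoleIntegrand dipoleIntegrandTop
    rw [tail_inClass_eq_tail_one hθ hf ⟨hy.1.le, hy.2.le⟩]
  unfold MformTop Mform
  rw [key 1, key 2, key 3]

/-- Pointwise, left slot: `D_j(s·u+v, f) = s·D_j(u,f) + D_j(v,f)`. [cite: Zhang2022LandauSiegel, Prop 7.1 p.44, (8.11)–(8.12)] -/
theorem dipoleIntegrandTop_glue_left {T : ℝ} (j : ℕ) (s : ℂ) (y : ℝ) :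
    dipoleIntegrandTop T j (fun t => s * u t + v t) (fun t => s * u' t + v' t) f f' y
      = s * dipoleIntegrandTop T j u u' f f' y + dipoleIntegrandTop T j v v' f f' y := by
  unfold dipoleIntegrandTop
  ring

/-- Pointwise, right slot (where both tails exist): `D_j(f, s·u+v) = s̄·D_j(f,u) + D_j(f,v)`.
[cite: Zhang2022LandauSiegel, Prop 7.1 p.44, (8.11)–(8.12)] -/
theorem dipoleIntegrandTop_glue_right {T : ℝ} (j : ℕ) (s : ℂ) {y : ℝ} (hiu : IntervalIntegrable u volume y T)
    (hiv : IntervalIntegrable v volume y T) :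
    dipoleIntegrandTop T j f f' (fun t => s * u t + v t) (fun t => s * u' t + v' t) y
      = conj s * dipoleIntegrandTop T j f f' u u' y + dipoleIntegrandTop T j f f' v v' y := by
  have htail : ∫ t in y..T, s * u t + v t = s * (∫ t in y..T, u t) + ∫ t in y..T, v t := by
    rw [intervalIntegral.integral_add (hiu.const_mul s) hiv, intervalIntegral.integral_const_mul]
  unfold dipoleIntegrandTop
  rw [htail]
  simp only [map_add, map_mul]
  ring

/-- `M_θ(s·u+v, f) = s·M_θ(u,f) + M_θ(v,f)` (in-class `u`, `f`, rough `v`, `θ ≥ 1`).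
[cite: Zhang2022LandauSiegel, Prop 7.1 p.44, (8.11)–(8.12)] -/
theorem MformTop_glue_left (hθ : 1 ≤ θ) (hu : InClassPiece u u') (hv : RoughOverhangPiece θ v v')
    (hf : InClassPiece f f') (s : ℂ) :
    MformTop θ (fun t => s * u t + v t) (fun t => s * u' t + v' t) f f' = s * MformTop θ u u' f f' + MformTop θ v v' f f' := by
  have key : ∀ j : ℕ, ∫ y in (0:ℝ)..θ, dipoleIntegrandTop θ j (fun t => s * u t + v t) (fun t => s * u' t + v' t) f f' y
      = s * (∫ y in (0:ℝ)..θ, dipoleIntegrandTop θ j u u' f f' y) + ∫ y in (0:ℝ)..θ, dipoleIntegrandTop θ j v v' f f' y := by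
    intro j
    have hA := (intervalIntegrable_dipoleTop_inClass hθ hu hf j).const_mul s
    have hB := intervalIntegrable_dipoleTop_vu hθ hf hv j
    simp_rw [dipoleIntegrandTop_glue_left]
    rw [intervalIntegral.integral_add hA hB, intervalIntegral.integral_const_mul]
  unfold MformTop
  rw [key 1, key 2, key 3]
  ring

/-- `M_θ(f, s·u+v) = s̄·M_θ(f,u) + M_θ(f,v)` (in-class `u`, `f`, rough `v`, `θ ≥ 1`).
[cite: Zhang2022LandauSiegel, Prop 7.1 p.44, (8.11)–(8.12)] -/
theorem MformTop_glue_right (hθ : 1 ≤ θ) (hu : InClassPiece u u') (hv : RoughOverhangPiece θ v v')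
    (hf : InClassPiece f f') (s : ℂ) :
    MformTop θ f f' (fun t => s * u t + v t) (fun t => s * u' t + v' t)
      = conj s * MformTop θ f f' u u' + MformTop θ f f' v v' := by
  have h0 : (0:ℝ) ≤ θ := zero_le_one.trans hθ
  have key : ∀ j : ℕ, ∫ y in (0:ℝ)..θ, dipoleIntegrandTop θ j f f' (fun t => s * u t + v t) (fun t => s * u' t + v' t) y
      = conj s * (∫ y in (0:ℝ)..θ, dipoleIntegrandTop θ j f f' u u' y)
        + ∫ y in (0:ℝ)..θ, dipoleIntegrandTop θ j f f' v v' y := by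
    intro j
    have hcongr : ∫ y in (0:ℝ)..θ, dipoleIntegrandTop θ j f f' (fun t => s * u t + v t) (fun t => s * u' t + v' t) y
        = ∫ y in (0:ℝ)..θ, (conj s * dipoleIntegrandTop θ j f f' u u' y + dipoleIntegrandTop θ j f f' v v' y) :=
      intervalIntegral.integral_congr_uIoo fun y hy => by
        rw [uIoo_of_le h0] at hy
        exact dipoleIntegrandTop_glue_right j s (hu.intervalIntegrable_sub hθ hy.1.le hy.2.le)
          (hv.intervalIntegrable_sub hθ hy.2.le)
    have hA := (intervalIntegrable_dipoleTop_inClass hθ hf hu j).const_mul (conj s)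
    have hB := intervalIntegrable_dipoleTop_uv hθ hf hv j
    rw [hcongr, intervalIntegral.integral_add hA hB, intervalIntegral.integral_const_mul]
  unfold MformTop
  rw [key 1, key 2, key 3]
  ring

/-- **THE JOINT GLUE IDENTITY.** For `θ ≥ 1`, in-class pieces `u`, `f`, a rough overhang piece `v` and any `s`, the
continued polar pairing of the glued profile `s·u + v` with the probe `f` IS p457753's cross
`twoPieceCross θ 0 u u′ v v′ s f f′ = s·P(u,f) + conj(π·conj(Φ_v)·L(f))`:
`M_θ(s·u+v, f) + conj M_θ(f, s·u+v) = twoPieceCross θ 0 u u′ v v′ s f f′` (Gram identity for the in-class pair,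
rough rank-one coupling for the overhang against the probe). [cite: Zhang2022LandauSiegel, §8 (8.11)–(8.12); §10 (10.17); §7 (7.2)] -/
theorem twoPieceCross_glue (hθ : 1 ≤ θ) (hu : InClassPiece u u') (hv : RoughOverhangPiece θ v v')
    (hf : InClassPiece f f') (s : ℂ) :
    MformTop θ (fun t => s * u t + v t) (fun t => s * u' t + v' t) f f'
        + conj (MformTop θ f f' (fun t => s * u t + v t) (fun t => s * u' t + v' t))
      = twoPieceCross θ 0 u u' v v' s f f' := by
  obtain ⟨hfv, hvf⟩ := rough_rankOneTailCoupling hθ hf hv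
  rw [MformTop_glue_left hθ hu hv hf s, MformTop_glue_right hθ hu hv hf s, MformTop_inClass_pair hθ hu hf,
    MformTop_inClass_pair hθ hf hu, hvf, hfv, twoPieceCross,
    mainTermFormPolar_eq_Mform hu.kinked hf.kinked (hu.vanish 1 le_rfl) (hf.vanish 1 le_rfl)]
  have e0 : ((0 : PairFunctional) f f' v v') = 0 := rfl
  rw [e0]
  simp only [map_add, map_mul, Complex.conj_conj, add_zero]
  ring

end JointGlue

end KnifeEdge

end Literature.NumberTheory.LFunctions.Zhang2022
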